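import Literature.Barriers.Parity.SiegelZeroPrimePairsCharSumTools
import HarnessLib

/-!
# Matomäki–Merikoski, Lemma 2.5: the complete character sums (2.7), (2.8), (2.9), proved

Sibling of `Literature/Barriers/Parity/SiegelZeroPrimePairs.lean` (the catalogue entry vendoring
Matomäki–Merikoski, *Siegel zeros, twin primes, Goldbach's conjecture, and primes in short
intervals* (IMRN 2023; arXiv:2112.11412), Theorem 1.3 as the named fact
`Literature.Barriers.Parity.MatomakiMerikoski2023_pairCorrelation`). Lemma 2.5 of the source (§2
"Initial steps"; proof in §3.4 "Character sums") evaluates, for a primitive quadratic character `χ` mod `q = 2^r q'` (`q'` odd),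
the principal character `χ₀` mod `q` and an even integer `h`, the complete sums
`(1/q)∑_{m (mod q)} χ₀(m)χ₀(±m+h)` (2.7), `(1/q)∑ χ(m)χ₀(±m+h)` (2.8), `(1/q)∑ χ(m)χ(±m+h)` (2.9);
(2.9) is the origin of the correction factor
`1 + 1_{φ(2^r) ∣ h} (−1)^{h/φ(2^r)} ∏_{p ∣ q', p ∤ h} (−1)/(p − 2)` in Theorem 1.3 ("Precise
evaluation of the character sum (2.9) is … the reason we can deal with the case `(h, q)` is
close to `q`"). This file PROVES all three, with `±1` generalised to any unit `ε` of `ℤ/q`: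

* `MatomakiMerikoski2023_charSum_principal` — (2.7), for every `q ≥ 1`, `h ∈ ℕ`;
* `MatomakiMerikoski2023_charSum_mixed` — (2.8) in CORRECTED form
  `(1/q)∑ χ(m)χ₀(εm+h) = μ(q) χ(−ε⁻¹h)/q` for every primitive `χ`: the source prints `−χ(∓h)/q`,
  which has the wrong sign when `q'` has an even number of prime factors (e.g. `q = 15`, `h = 2`:
  the sum is `+χ(−2)`); its proof evaluates the prime case correctly (`−χ(∓h)`) but the signs
  multiply to `μ(q')` under the Chinese remainder theorem. Harmless in the source, where (2.8)
  only enters as `O(1/q)`; both forms agree for `q'` prime and vanish when `4 ∣ q`, `h` even;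
* `MatomakiMerikoski2023_charSum_quadratic` — (2.9) as printed, for primitive quadratic `χ`
  and even `h ∈ ℕ`;
* `MatomakiMerikoski2023_charSum_quadratic_eq_principal_mul` — the combination printed in §7:
  `∑ χ(m)χ(±m+h) = χ(±1) ∑ χ₀(m)χ₀(±m+h) · 1_{φ(2^r) ∣ h}(−1)^{h/φ(2^r)} ∏_{p ∣ q', p ∤ h} (−1)/(p−2)`,
  i.e. exactly the correction factor of Theorem 1.3.

Method (different from the source's prime-by-prime CRT computation, same result): the sums are
Ramanujan sums — `∑_m χ(m)χ(εm+h) = χ(ε) c_q(h)` and `∑_{u ∈ (ℤ/q)ˣ} χ(1 + a u) = c_q(a)` for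
primitive `χ` (`SiegelZeroPrimePairsCharSumTools.lean`), evaluated through Kluyver's form,
multiplicativity, and the squarefreeness of `q'`
(`Literature.Barriers.Parity.SiegelCorr.squarefree_oddPart`).

## References

* K. Matomäki, J. Merikoski, *Siegel zeros, twin primes, Goldbach's conjecture, and primes in
  short intervals*, IMRN 2023:23, 20337–20384 (arXiv:2112.11412): Lemma 2.5 ((2.7)–(2.9), §2) and
  its proof, §3.4 "Character sums" (read in the held TeX-derived text, `lit read arxiv:2112.11412`).
  [cite: MatomakiMerikoski2023, Lemma 2.5]
-/

noncomputable section

open Finset DirichletCharacter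
open scoped ArithmeticFunction.Moebius

/-! ### Lemma 2.5, (2.9), as printed -/

namespace Literature.Barriers.Parity

open Literature.NumberTheory.Sieve Literature.NumberTheory.Sieve.MontgomeryVaughan1975
  MatomakiMerikoski

/-- **Matomäki–Merikoski 2023, Lemma 2.5, eq. (2.9)** (as printed: "Let `q ≥ 2` and let `χ` be a
primitive quadratic character of modulus `q = 2^r q'` with `r ≥ 0` and `2 ∤ q'`. … let `h` be
an even integer. Then
`(1/q) ∑_{m (mod q)} χ(m) χ(±m + h) = 1_{φ(2^r) ∣ h} (−1)^{h/φ(2^r)} χ(±1) ∏_{p ∣ (q,h)} (1 − 1/p) ∏_{p ∣ q, p ∤ h} (−1)/p`"),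
PROVED, for every unit `ε` of `ℤ/q` in place of `±1` (so `χ(±1)` reads `χ(ε)`) and even `h ∈ ℕ`;
`r = padicValNat 2 q`. This complete character sum is the origin of the correction factor
`1 + 1_{φ(2^r) ∣ h} (−1)^{h/φ(2^r)} ∏_{p ∣ q', p ∤ h} (−1)/(p − 2)` of Theorem 1.3
(`MatomakiMerikoski2023_pairCorrelation`). Proof: the sum equals `χ(ε) c_q(h)`
(`MatomakiMerikoski.sum_apply_mul_apply_add`, a Ramanujan sum), `c_q(h) = c_{2^r}(h) c_{q'}(h)`,
`q'` is squarefree (`SiegelCorr.squarefree_oddPart`), and the local values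
`MatomakiMerikoski.ramanujanDivisorSum_two_pow_div`, `…_div_of_squarefree`.
[cite: MatomakiMerikoski2023, Lemma 2.5 (2.9)] -/
theorem MatomakiMerikoski2023_charSum_quadratic {q : ℕ} [NeZero q] (χ : DirichletCharacter ℂ q)
    (hχ : χ.IsPrimitive) (hχ2 : χ.IsQuadratic) (ε : (ZMod q)ˣ) {h : ℕ} (hh : Even h) :
    (1 / (q : ℂ)) * ∑ m : ZMod q, χ m * χ (ε * m + h) =
      (if Nat.totient (2 ^ padicValNat 2 q) ∣ h then
          (-1 : ℂ) ^ (h / Nat.totient (2 ^ padicValNat 2 q)) else 0) * χ ε *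
        ((∏ p ∈ q.primeFactors.filter (fun p => p ∣ h), (1 - 1 / (p : ℂ))) *
          ∏ p ∈ q.primeFactors.filter (fun p => ¬ p ∣ h), (-1 / (p : ℂ))) := by
  have hq0 : q ≠ 0 := NeZero.ne q
  set r := padicValNat 2 q with hrdef
  set q' := q / 2 ^ r with hq'def
  have hfac : 2 ^ r * q' = q := by
    rw [hq'def, hrdef, ← Nat.factorization_def q Nat.prime_two]
    exact Nat.ordProj_mul_ordCompl_eq_self q 2
  have hq'0 : q' ≠ 0 := fun h0 => hq0 (by rw [← hfac, h0, mul_zero])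
  have hodd : ¬ 2 ∣ q' := SiegelCorr.two_not_dvd_oddPart q
  have hcop : Nat.Coprime (2 ^ r) q' :=
    Nat.Coprime.pow_left r ((Nat.Prime.coprime_iff_not_dvd Nat.prime_two).mpr hodd)
  have hsq : Squarefree q' := SiegelCorr.squarefree_oddPart χ hχ hχ2
  -- the character sum is `χ(ε) c_q(h)` and `c_q(h) = c_{2^r}(h) c_{q'}(h)`
  rw [sum_apply_mul_apply_add χ hχ hχ2 ε h, ← Finset.prod_ite]
  have hc : (ramanujanDivisorSum h q : ℂ) =
      (ramanujanDivisorSum h (2 ^ r) : ℂ) * (ramanujanDivisorSum h q' : ℂ) := by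
    rw [← Int.cast_mul, ← (isMultiplicative_ramanujanDivisorSum h).map_mul_of_coprime hcop, hfac]
  have hqc : (q : ℂ) = (2 : ℂ) ^ r * q' := by rw [← hfac]; push_cast; ring
  have hpf : q.primeFactors = (2 ^ r).primeFactors ∪ q'.primeFactors := by
    rw [← hfac]; exact Nat.primeFactors_mul (pow_ne_zero _ two_ne_zero) hq'0
  have hdisj : Disjoint (2 ^ r).primeFactors q'.primeFactors := hcop.disjoint_primeFactors
  rw [hpf, Finset.prod_union hdisj, ← ramanujanDivisorSum_div_of_squarefree h hsq, hc, hqc]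
  have hq'c : (q' : ℂ) ≠ 0 := Nat.cast_ne_zero.mpr hq'0
  have h2c : (2 : ℂ) ^ r ≠ 0 := pow_ne_zero _ two_ne_zero
  -- the `2`-part
  have htwo : (ramanujanDivisorSum h (2 ^ r) : ℂ) / (2 : ℂ) ^ r =
      (if Nat.totient (2 ^ r) ∣ h then (-1 : ℂ) ^ (h / Nat.totient (2 ^ r)) else 0) *
        ∏ p ∈ (2 ^ r).primeFactors, (if p ∣ h then (1 - 1 / (p : ℂ)) else (-1 / (p : ℂ))) := by
    rcases Nat.eq_zero_or_pos r with hr0 | hrpos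
    · rw [hr0, pow_zero, Nat.totient_one, Nat.div_one, if_pos (one_dvd h), hh.neg_one_pow,
        Nat.primeFactors_one, Finset.prod_empty, (isMultiplicative_ramanujanDivisorSum h).map_one]
      simp
    · have hφ : Nat.totient (2 ^ r) = 2 ^ (r - 1) := by
        rw [Nat.totient_prime_pow Nat.prime_two hrpos]; simp
      rw [ramanujanDivisorSum_two_pow_div h hrpos, hφ,
        Nat.primeFactors_prime_pow hrpos.ne' Nat.prime_two, Finset.prod_singleton,
        if_pos (even_iff_two_dvd.mp hh)]
      have h12 : (1 : ℂ) - 1 / ((2 : ℕ) : ℂ) = 1 / 2 := by norm_num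
      rw [h12]
      split_ifs <;> ring
  calc 1 / ((2 : ℂ) ^ r * q') * (χ ε * ((ramanujanDivisorSum h (2 ^ r) : ℂ) * (ramanujanDivisorSum h q' : ℂ)))
      = χ ε * ((ramanujanDivisorSum h (2 ^ r) : ℂ) / (2 : ℂ) ^ r) *
          ((ramanujanDivisorSum h q' : ℂ) / q') := by field_simp
    _ = _ := by rw [htwo]; ring

/-- **Matomäki–Merikoski 2023, Lemma 2.5, eq. (2.8), in corrected form.** For a primitive
character `χ` mod `q`, the principal character `χ₀` mod `q`, a unit `ε` and `h ∈ ℕ`: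
`(1/q) ∑_{m (mod q)} χ(m) χ₀(ε m + h) = μ(q) χ(−ε⁻¹ h)/q`.
The source prints (2.8) as `(1/q) ∑_{m (mod q)} χ(m) χ₀(±m + h) = −χ(∓h)/q` (for `χ` primitive
quadratic mod `q = 2^r q'`, `h` even), proving the prime case `∑_{m (mod p)} χ(m)χ₀(±m+h) = −χ(∓h)`
and "combining these" by the Chinese remainder theorem (§3.4); but the local signs multiply to
`μ(q')`, not `−1`: e.g. for `q = 15`, `h = 2` the sum is `+χ(−2)`, not `−χ(−2)` (checked
numerically). The two forms agree when `q'` is a prime or `4 ∣ q` (both sides vanish for even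
`h`), and the discrepancy is immaterial in the source, where (2.8) only enters as `O(1/q)`.
Proof: substituting `y = ε m + h` and inverting the condition `(y, q) = 1` by Möbius
(`MatomakiMerikoski.sum_range_coprime_eq_sum_divisors`), the inner sums
`∑_{i < q/d} χ(ε⁻¹(d i − h))` vanish for `d < q` by primitivity
(`MatomakiMerikoski.sum_range_div_apply_add`) and the term `d = q` is `μ(q) χ(−ε⁻¹ h)`.
[cite: MatomakiMerikoski2023, Lemma 2.5 (2.8)] -/
theorem MatomakiMerikoski2023_charSum_mixed {q : ℕ} [NeZero q] (χ : DirichletCharacter ℂ q)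
    (hχ : χ.IsPrimitive) (ε : (ZMod q)ˣ) (h : ℕ) :
    (1 / (q : ℂ)) * ∑ m : ZMod q, χ m * (1 : DirichletCharacter ℂ q) (ε * m + h) =
      (μ q : ℂ) * χ (-(((ε⁻¹ : (ZMod q)ˣ) : ZMod q) * h)) / q := by
  have hq0 : q ≠ 0 := NeZero.ne q
  set G : ZMod q → ℂ := fun y => χ (((ε⁻¹ : (ZMod q)ˣ) : ZMod q) * (y - h)) *
    (1 : DirichletCharacter ℂ q) y with hG
  -- substitute `y = ε m + h`
  have h1 : ∑ m : ZMod q, χ m * (1 : DirichletCharacter ℂ q) (ε * m + h) = ∑ y : ZMod q, G y := by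
    rw [← Equiv.sum_comp ((Units.mulLeft ε).trans (Equiv.addRight (h : ZMod q))) G]
    refine Fintype.sum_congr _ _ fun m => ?_
    simp only [hG, Equiv.trans_apply, Units.mulLeft_apply, Equiv.coe_addRight, add_sub_cancel_right,
      Units.inv_mul_cancel_left]
  -- Möbius inversion on `(y, q) = 1`
  have h2 : ∑ y : ZMod q, G y = ∑ j ∈ range q, (if j.Coprime q then (1 : ℂ) else 0) *
      χ (((ε⁻¹ : (ZMod q)ˣ) : ZMod q) * ((j : ZMod q) - h)) := by
    rw [← sum_range_eq_sum_zmod G]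
    refine sum_congr rfl fun j _ => ?_
    simp only [hG]
    by_cases hj : j.Coprime q
    · rw [if_pos hj, MulChar.one_apply ((ZMod.isUnit_iff_coprime j q).mpr hj), mul_one, one_mul]
    · rw [if_neg hj, MulChar.map_nonunit _ (mt (ZMod.isUnit_iff_coprime j q).mp hj), mul_zero,
        zero_mul]
  have h3 : ∀ d ∈ q.divisors, ∑ i ∈ range (q / d),
      χ (((ε⁻¹ : (ZMod q)ˣ) : ZMod q) * (((d * i : ℕ) : ZMod q) - h)) =
        χ ((ε⁻¹ : (ZMod q)ˣ) : ZMod q) *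
          (if q ∣ 1 * d then ((q / d : ℕ) : ℂ) * χ (-(h : ZMod q)) else 0) := by
    intro d hd
    have hdq : d ∣ q := Nat.dvd_of_mem_divisors hd
    rw [← sum_range_div_apply_add χ hχ (-(h : ZMod q)) 1 hdq, mul_sum]
    refine sum_congr rfl fun i _ => ?_
    rw [← map_mul]
    congr 1
    push_cast; ring
  rw [h1, h2, sum_range_coprime_eq_sum_divisors, sum_congr rfl fun d hd => by rw [h3 d hd],
    Finset.sum_eq_single q, if_pos (by rw [one_mul]), Nat.div_self (NeZero.pos q), Nat.cast_one,
    one_mul]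
  · rw [← map_mul, show (((ε⁻¹ : (ZMod q)ˣ) : ZMod q)) * (-(h : ZMod q)) =
      -((((ε⁻¹ : (ZMod q)ˣ) : ZMod q)) * h) by ring]
    have hqc : (q : ℂ) ≠ 0 := Nat.cast_ne_zero.mpr hq0
    field_simp
  · intro d hd hdq
    have hdvd : d ∣ q := Nat.dvd_of_mem_divisors hd
    have hnd : ¬ q ∣ 1 * d := by
      rw [one_mul]
      intro h'
      exact hdq (Nat.dvd_antisymm hdvd h')
    rw [if_neg hnd, mul_zero, mul_zero]
  · intro hq
    exact absurd (Nat.mem_divisors_self q hq0) hq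

/-- **Matomäki–Merikoski 2023, Lemma 2.5, eq. (2.7)** (as printed:
"`(1/q) ∑_{m (mod q)} χ₀(m) χ₀(±m + h) = ∏_{p ∣ (q,h)} (1 − 1/p) ∏_{p ∣ q, p ∤ h} (1 − 2/p)`",
`χ₀` the principal character mod `q`), PROVED for every `q ≥ 1`, every `h ∈ ℕ` and every unit
`ε` in place of `±1` (the source states it for `q` carrying a primitive quadratic character and
`h` even, but neither is used). Proof: the sum counts the units `u` with `u + h` a unit (after
`m ↦ ε m`); Möbius inversion on `(u + h, q) = 1`
(`MatomakiMerikoski.coprime_indicator_eq_sum_divisors_ite`) and the fibre count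
`MatomakiMerikoski.card_units_filter_dvd_add` give `φ(q) ∑_{d ∣ q, (d,h)=1} μ(d)/φ(d)
= φ(q) ∏_{p ∣ q, p ∤ h} (1 − 1/(p−1))`
(`MatomakiMerikoski.sum_divisors_moebius_mul_coprime_div_totient`), and `φ(q)/q = ∏_{p ∣ q} (1 − 1/p)`.
[cite: MatomakiMerikoski2023, Lemma 2.5 (2.7)] -/
theorem MatomakiMerikoski2023_charSum_principal {q : ℕ} [NeZero q] (ε : (ZMod q)ˣ) (h : ℕ) :
    (1 / (q : ℂ)) * ∑ m : ZMod q,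
        (1 : DirichletCharacter ℂ q) m * (1 : DirichletCharacter ℂ q) (ε * m + h) =
      (∏ p ∈ q.primeFactors.filter (fun p => p ∣ h), (1 - 1 / (p : ℂ))) *
        ∏ p ∈ q.primeFactors.filter (fun p => ¬ p ∣ h), (1 - 2 / (p : ℂ)) := by
  have hq0 : q ≠ 0 := NeZero.ne q
  -- the sum counts units `u` with `u + h` a unit
  have h1 : ∑ m : ZMod q, (1 : DirichletCharacter ℂ q) m * (1 : DirichletCharacter ℂ q) (ε * m + h) =
      ∑ u : (ZMod q)ˣ, (1 : DirichletCharacter ℂ q) ((u : ZMod q) + h) := by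
    rw [← sum_units_eq_sum (fun m => (1 : DirichletCharacter ℂ q) m *
        (1 : DirichletCharacter ℂ q) (ε * m + h))
      (fun m hm => by rw [MulChar.map_nonunit _ hm, zero_mul])]
    simp_rw [MulChar.one_apply_coe, one_mul]
    have := Equiv.sum_comp (Equiv.mulLeft ε) (fun u : (ZMod q)ˣ =>
      (1 : DirichletCharacter ℂ q) ((u : ZMod q) + h))
    rw [← this]
    refine Fintype.sum_congr _ _ fun u => ?_
    simp only [Equiv.coe_mulLeft, Units.val_mul]
  -- Möbius inversion on `(u + h, q) = 1` and the fibre count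
  have h2 : ∀ u : (ZMod q)ˣ, (1 : DirichletCharacter ℂ q) ((u : ZMod q) + h) =
      ∑ d ∈ q.divisors, if d ∣ ((u : ZMod q) + h).val then (μ d : ℂ) else 0 := by
    intro u
    rw [← coprime_indicator_eq_sum_divisors_ite]
    by_cases hu : IsUnit ((u : ZMod q) + h)
    · rw [MulChar.one_apply hu, if_pos]
      rwa [← ZMod.natCast_zmod_val ((u : ZMod q) + (h : ZMod q)), ZMod.isUnit_iff_coprime] at hu
    · rw [MulChar.map_nonunit _ hu, if_neg]
      rwa [← ZMod.natCast_zmod_val ((u : ZMod q) + (h : ZMod q)), ZMod.isUnit_iff_coprime] at hu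
  have h3 : ∑ u : (ZMod q)ˣ, (1 : DirichletCharacter ℂ q) ((u : ZMod q) + h) =
      (Nat.totient q : ℂ) * ∑ d ∈ q.divisors,
        (μ d : ℂ) * (if d.Coprime h then 1 / (Nat.totient d : ℂ) else 0) := by
    simp_rw [h2]
    rw [sum_comm, mul_sum]
    refine sum_congr rfl fun d hd => ?_
    have hdq : d ∣ q := Nat.dvd_of_mem_divisors hd
    have hd0 : d ≠ 0 := (Nat.pos_of_mem_divisors hd).ne'
    rw [← sum_filter, sum_const, nsmul_eq_mul, card_units_filter_dvd_add hdq h]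
    by_cases hcop : d.Coprime h
    · rw [if_pos hcop, if_pos hcop]
      have hφd : (Nat.totient d : ℂ) ≠ 0 :=
        Nat.cast_ne_zero.mpr (Nat.totient_pos.mpr (Nat.pos_of_ne_zero hd0)).ne'
      have hdvd : Nat.totient d ∣ Nat.totient q := by
        haveI : NeZero d := ⟨hd0⟩
        have := card_fiber_mul_totient hdq (1 : (ZMod d)ˣ) (q := q)
        exact ⟨_, by rw [← this, mul_comm]⟩
      rw [Nat.cast_div hdvd hφd]
      field_simp
    · rw [if_neg hcop, if_neg hcop]
      simp
  -- `φ(q)/q = ∏ (1 − 1/p)` and the local factors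
  have hφ : (Nat.totient q : ℂ) = q * ∏ p ∈ q.primeFactors, (1 - 1 / (p : ℂ)) := by
    have := Nat.totient_eq_mul_prod_factors q
    have hcast : (Nat.totient q : ℂ) = ((Nat.totient q : ℚ) : ℂ) := (Rat.cast_natCast _).symm
    rw [hcast, this]
    push_cast
    refine congrArg (fun x => (q : ℂ) * x) (prod_congr rfl fun p _ => ?_)
    rw [one_div]
  rw [h1, h3, sum_divisors_moebius_mul_coprime_div_totient, hφ, ← Finset.prod_ite,
    show 1 / (q : ℂ) * ((q : ℂ) * (∏ p ∈ q.primeFactors, (1 - 1 / (p : ℂ))) *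
        ∏ p ∈ q.primeFactors, (1 - if p.Coprime h then 1 / (Nat.totient p : ℂ) else 0)) =
      (∏ p ∈ q.primeFactors, (1 - 1 / (p : ℂ))) *
        ∏ p ∈ q.primeFactors, (1 - if p.Coprime h then 1 / (Nat.totient p : ℂ) else 0) by
      field_simp [Nat.cast_ne_zero.mpr hq0], ← prod_mul_distrib]
  refine prod_congr rfl fun p hp => ?_
  have hpr := Nat.prime_of_mem_primeFactors hp
  have hp0 : (p : ℂ) ≠ 0 := Nat.cast_ne_zero.mpr hpr.ne_zero
  have hp1 : (p : ℂ) - 1 ≠ 0 := by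
    have : (1 : ℂ) ≠ p := by exact_mod_cast hpr.one_lt.ne
    exact sub_ne_zero.mpr this.symm
  rw [Nat.totient_prime hpr, Nat.cast_sub hpr.one_le, Nat.cast_one]
  by_cases hph : p ∣ h
  · rw [if_pos hph, if_neg (fun hc => ((Nat.Prime.coprime_iff_not_dvd hpr).mp hc) hph), sub_zero,
      mul_one]
  · rw [if_neg hph, if_pos ((Nat.Prime.coprime_iff_not_dvd hpr).mpr hph)]
    field_simp
    ring

/-- **The two complete sums compared** (Matomäki–Merikoski, §7, proof of Theorems 1.3–1.4, as
printed: "Recall that `2 ∣ h` so that by Lemma 2.5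
`∑_{m (mod q)} χ(m(±m+h)) = χ(±1) ∑_{m (mod q)} χ₀(m)χ₀(±m+h) · 1_{φ(2^r) ∣ h} (−1)^{h/φ(2^r)} ∏_{p ∣ q', p ∤ h} (−1)/(p−2)`"):
this is how (2.7) and (2.9) combine into the correction factor of Theorem 1.3
(`MatomakiMerikoski2023_pairCorrelation`; `q' = q/2^r` the odd part). PROVED from
`MatomakiMerikoski2023_charSum_quadratic` and `MatomakiMerikoski2023_charSum_principal`, for any
unit `ε` in place of `±1`: for even `h` the primes `p ∣ q` with `p ∤ h` are exactly the
`p ∣ q'` with `p ∤ h`, and `(1 − 2/p) · (−1)/(p − 2) = −1/p` for odd `p`.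
[cite: MatomakiMerikoski2023, §7 (proof of Theorems 1.3 and 1.4)] -/
theorem MatomakiMerikoski2023_charSum_quadratic_eq_principal_mul {q : ℕ} [NeZero q]
    (χ : DirichletCharacter ℂ q) (hχ : χ.IsPrimitive) (hχ2 : χ.IsQuadratic) (ε : (ZMod q)ˣ)
    {h : ℕ} (hh : Even h) :
    ∑ m : ZMod q, χ m * χ (ε * m + h) =
      χ ε * (∑ m : ZMod q, (1 : DirichletCharacter ℂ q) m * (1 : DirichletCharacter ℂ q) (ε * m + h)) *
        ((if Nat.totient (2 ^ padicValNat 2 q) ∣ h then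
            (-1 : ℂ) ^ (h / Nat.totient (2 ^ padicValNat 2 q)) else 0) *
          ∏ p ∈ (q / 2 ^ padicValNat 2 q).primeFactors.filter (fun p => ¬ p ∣ h),
            (-1 / ((p : ℂ) - 2))) := by
  have hq0 : q ≠ 0 := NeZero.ne q
  have hqc : (q : ℂ) ≠ 0 := Nat.cast_ne_zero.mpr hq0
  have hA := MatomakiMerikoski2023_charSum_quadratic χ hχ hχ2 ε hh
  have hB := MatomakiMerikoski2023_charSum_principal ε h (q := q)
  rw [one_div, inv_mul_eq_iff_eq_mul₀ hqc] at hA hB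
  rw [hA, hB]
  -- the index sets: for even `h`, `{p ∣ q : p ∤ h} = {p ∣ q' : p ∤ h}`
  set r := padicValNat 2 q with hrdef
  set q' := q / 2 ^ r with hq'def
  have hfac : 2 ^ r * q' = q := by
    rw [hq'def, hrdef, ← Nat.factorization_def q Nat.prime_two]
    exact Nat.ordProj_mul_ordCompl_eq_self q 2
  have hq'0 : q' ≠ 0 := fun h0 => hq0 (by rw [← hfac, h0, mul_zero])
  have hodd : ¬ 2 ∣ q' := SiegelCorr.two_not_dvd_oddPart q
  have h2h : 2 ∣ h := even_iff_two_dvd.mp hh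
  have hset : q.primeFactors.filter (fun p => ¬ p ∣ h) = q'.primeFactors.filter (fun p => ¬ p ∣ h) := by
    ext p
    simp only [Finset.mem_filter, Nat.mem_primeFactors_of_ne_zero hq0,
      Nat.mem_primeFactors_of_ne_zero hq'0]
    constructor
    · rintro ⟨⟨hp, hpq⟩, hph⟩
      refine ⟨⟨hp, ?_⟩, hph⟩
      have hp2 : p ≠ 2 := fun h2 => hph (h2 ▸ h2h)
      have hcop : Nat.Coprime p (2 ^ r) :=
        Nat.Coprime.pow_right r ((Nat.coprime_primes hp Nat.prime_two).mpr hp2)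
      rw [← hfac] at hpq
      exact hcop.dvd_of_dvd_mul_left hpq
    · rintro ⟨⟨hp, hpq'⟩, hph⟩
      exact ⟨⟨hp, hpq'.trans ⟨2 ^ r, by rw [mul_comm, hfac]⟩⟩, hph⟩
  have hP : ∀ p ∈ q'.primeFactors.filter (fun p => ¬ p ∣ h),
      (1 - 2 / (p : ℂ)) * (-1 / ((p : ℂ) - 2)) = -1 / (p : ℂ) := by
    intro p hp
    have hp' := (Finset.mem_filter.mp hp).1
    have hpr := Nat.prime_of_mem_primeFactors hp'
    have hp2 : p ≠ 2 := by
      rintro rfl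
      exact hodd (Nat.dvd_of_mem_primeFactors hp')
    have h3 : (3 : ℝ) ≤ p := by exact_mod_cast lt_of_le_of_ne hpr.two_le (Ne.symm hp2)
    have hp0 : (p : ℂ) ≠ 0 := Nat.cast_ne_zero.mpr hpr.ne_zero
    have hpm2 : (p : ℂ) - 2 ≠ 0 := by
      have : ((p : ℝ) - 2 : ℝ) ≠ 0 := by linarith
      exact_mod_cast (by exact_mod_cast this : ((p : ℂ) - 2) ≠ 0)
    field_simp
  rw [hset, show ∀ (I X P N₁ N₂ N₃ : ℂ), N₁ = N₂ * N₃ →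
      (q : ℂ) * (I * X * (P * N₁)) = X * ((q : ℂ) * (P * N₂)) * (I * N₃) from
      fun I X P N₁ N₂ N₃ hN => by rw [hN]; ring]
  rw [← Finset.prod_mul_distrib]
  exact (Finset.prod_congr rfl hP).symm

end Literature.Barriers.Parity

end
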